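import Summits.ValiantsHypothesis.ValiantsHypothesis.Theses.BoolTransfer
import Literature.Computability.AlgebraicComplexity.BurgisserFiniteFields
import Literature.Computability.AlgebraicComplexity.BurgisserFiniteFieldsProofs

/-!
# Birth skeleton for crux `FpBarCollapse` (stmt-ValiantsHypothesis-1318) of route BoolTransfer

Crux (fixed, the route's decl):
`FpBarCollapse : ∀ (p : ℕ) [Fact p.Prime], VP F̄_p = VNP F̄_p → NP ⊆ P/poly`,
`F̄_p = AlgebraicClosure (ZMod p)` — Bürgisser's printed open Problem (TCS 235 (2000) p. 74).

Line = Bürgisser's proof of Cor. 1.2(2) (TCS p. 79) run over the INFINITE field `F̄_p`: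
`NP ⊆ Mod_pNP/poly` (Thm. 3.1, in tree: `NP_subset_polyAdvice_ModpNP`) `⊆ (P/poly)/poly = P/poly`,
where `Mod_pNP ⊆ P/poly` needs, for the p-definable family `f^φ` of a `#P` function `φ` ((B2), in
tree for every field: `sharpP_booleanPart_VNP_holds`), made p-computable by `VP F̄_p = VNP F̄_p`
(`isVPFamily_of_VP_eq_VNP`), that its Boolean fibres `{x | f_n(x) = 1}` lie in `P/poly`.  Over a
FINITE field this is (B3) (one-hot Boolean simulation, in tree).  Over `F̄_p` the circuit constants
live in `F_{p^{e}}` with `e` a priori up to `2^{poly(n)}`; the whole open content is split into the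
two stubs below:

* `stub_booleanDescent` — the DEGREE HALF (open): under `VP F̄_p = VNP F̄_p`, a p-computable family
  over `F̄_p` whose values on Boolean points are natural numbers (i.e. lie in the prime field) is
  computed ON BOOLEAN POINTS by fan-in-two circuits of p-bounded size whose constants lie in
  `GaloisField p (e n)` with `e` p-bounded (circuits over `F_{p^{e(n)}}` mapped into `F̄_p` along
  some embedding `φ`).  Only Boolean agreement is asked (the variety of admissible constant
  vectors for Boolean agreement is still defined over `F_p`), and the circuit/skeleton may change —
  this is exactly the freedom the refuter's fixed-skeleton obstruction (roots of `Φ_{3^{k+1}}` over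
  `F_2`, degree `2·3^k`) does not touch.
* `stub_booleanSimulation` — the SIMULATION HALF (known-type, not in tree: the tree's (B3) one-hot
  simulation is for a FIXED finite field): such bounded-degree circuits are simulated by Boolean
  circuits of size poly(s, e, log p) (coordinates over `F_p`, bilinear multiplication with the
  structure constants of `GaloisField p e` as advice), so every fibre `{w | f_{|w|}(w) = a}` is in
  `P/poly`.

`fpBarCollapse_of_descent_of_simulation` is the kernel-checked composition of the two stub STATEMENTS (hypotheses
form, no sorry); `FpBarCollapse_of : BoolTransfer.FpBarCollapse` applies it to the two registered stubs
by name (the shape `ledger skeleton check` registers): stubs ⇒ `Mod_pNP ⊆ P/poly` ⇒ crux.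
Disproof used: no `Disproof.lean` exists for this crux yet (ledger crux ls: no workfiles); the
refuter's crux-attack (W.lean / EVIDENCE.md, 2026-08-15) classifies the crux as open with honest
content = F̄_p constant elimination (its `B3bar`), which is `stub_booleanDescent ∘ stub_booleanSimulation` here.
-/

namespace Summit.ValiantsHypothesis.ValiantsHypothesis.Cruxes.FpBarCollapse.Birth

open MvPolynomial Literature.Computability.Complexity Literature.Computability.Complexity.Nondeterministic
  Literature.Computability.AlgebraicComplexity

/-- **Stub 1 (degree half, open): Boolean descent of constants from `F̄_p` to `F_{p^{poly}}`.**
Under `VP F̄_p = VNP F̄_p`: for every p-computable family `f` over `F̄_p = AlgebraicClosure (ZMod p)`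
whose values on Boolean points are natural numbers, there are p-bounded `e s : ℕ → ℕ` and, for each
`n`, a fan-in-two circuit `P` of size `≤ s n` with constants in `GaloisField p (e n)` and an embedding
`φ : GaloisField p (e n) →+* F̄_p` such that `P.map φ` agrees with `f n` on `{0,1}ⁿ`.
(Bürgisser 2000 TCS p. 74 Problem, "degree half"; sources: Burgisser2000TCS Cor. 1.2(2) and p. 79,
arXiv:2406.06217 p. 17.) -/
theorem stub_booleanDescent :
    ∀ (p : ℕ) [Fact p.Prime],
      VP (AlgebraicClosure (ZMod p)) = VNP (AlgebraicClosure (ZMod p)) →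
      ∀ f : (n : ℕ) → MvPolynomial (Fin n) (AlgebraicClosure (ZMod p)), IsVPFamily f →
        (∀ n (x : Fin n → Bool), ∃ N : ℕ, eval (boolPoint (AlgebraicClosure (ZMod p)) x) (f n) = N) →
        ∃ e s : ℕ → ℕ, IsPBounded e ∧ IsPBounded s ∧ ∀ n : ℕ,
          ∃ (φ : GaloisField p (e n) →+* AlgebraicClosure (ZMod p))
            (P : ArithCircuit (GaloisField p (e n)) (Fin n)),
            P.IsFanInTwo ∧ P.size ≤ s n ∧
              ∀ x : Fin n → Bool,
                eval (boolPoint (AlgebraicClosure (ZMod p)) x) (P.map φ).eval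
                  = eval (boolPoint (AlgebraicClosure (ZMod p)) x) (f n) := by
  sorry

/-- **Stub 2 (simulation half): Boolean simulation of bounded-degree circuits.**
For a family `f` over `F̄_p` with natural-number values on Boolean points which is computed on
Boolean points by fan-in-two circuits of p-bounded size with constants in `GaloisField p (e n)`,
`e` p-bounded, every fibre language `{w | f_{|w|}(w) = a}` is in `P/poly` (coordinates over `F_p`,
`+` linear, `×` bilinear with the structure constants of `F_{p^{e(n)}}` hard-wired as advice:
poly(s(n), e(n), log p) Boolean gates).  (Bürgisser 2000 TCS §5 (B) p. 87 is the fixed-finite-field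
case = tree `booleanPart_VP_NC_two_of_finite_holds`; the growing-field case is not in tree.) -/
theorem stub_booleanSimulation :
    ∀ (p : ℕ) [Fact p.Prime] (f : (n : ℕ) → MvPolynomial (Fin n) (AlgebraicClosure (ZMod p))),
      (∀ n (x : Fin n → Bool), ∃ N : ℕ, eval (boolPoint (AlgebraicClosure (ZMod p)) x) (f n) = N) →
      (∃ e s : ℕ → ℕ, IsPBounded e ∧ IsPBounded s ∧ ∀ n : ℕ,
          ∃ (φ : GaloisField p (e n) →+* AlgebraicClosure (ZMod p))
            (P : ArithCircuit (GaloisField p (e n)) (Fin n)),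
            P.IsFanInTwo ∧ P.size ≤ s n ∧
              ∀ x : Fin n → Bool,
                eval (boolPoint (AlgebraicClosure (ZMod p)) x) (P.map φ).eval
                  = eval (boolPoint (AlgebraicClosure (ZMod p)) x) (f n)) →
      ∀ a : AlgebraicClosure (ZMod p),
        {w : List Bool | eval (boolPoint (AlgebraicClosure (ZMod p)) w.get) (f w.length) = a} ∈ PPoly := by
  sorry

/-- **Composition, hypotheses form (kernel-checked, no sorry; axioms propext/Classical.choice/Quot.sound):**
the two stub STATEMENTS give the crux statement by Bürgisser's chain (TCS p. 79) over `F̄_p`: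
`NP ⊆ Mod_pNP/poly` (Thm. 3.1, tree `NP_subset_polyAdvice_ModpNP`) and `Mod_pNP ⊆ P/poly` — for
`L ∈ Mod_pNP` with `φ ∈ #P`, (B2) (`sharpP_booleanPart_VNP_holds`, any field) gives a p-definable `f`
with `f_n(x) = φ(x) · 1`, the hypothesis makes it p-computable (`isVPFamily_of_VP_eq_VNP`), descent
bounds the degree of its constants and simulation puts the fibre `{f = 1} = L`
(`natCast_eq_one_iff_mod`) in `P/poly`; finally `(P/poly)/poly ⊆ P/poly` (`polyAdvice_subset_PPoly`).
The conclusion is the crux statement UNFOLDED (definitionally `BoolTransfer.FpBarCollapse`), so that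
the skeleton audit sees exactly one theorem concluding the crux BY NAME: `FpBarCollapse_of` below. -/
theorem fpBarCollapse_of_descent_of_simulation
    (hDescent : ∀ (p : ℕ) [Fact p.Prime],
      VP (AlgebraicClosure (ZMod p)) = VNP (AlgebraicClosure (ZMod p)) →
      ∀ f : (n : ℕ) → MvPolynomial (Fin n) (AlgebraicClosure (ZMod p)), IsVPFamily f →
        (∀ n (x : Fin n → Bool), ∃ N : ℕ, eval (boolPoint (AlgebraicClosure (ZMod p)) x) (f n) = N) →
        ∃ e s : ℕ → ℕ, IsPBounded e ∧ IsPBounded s ∧ ∀ n : ℕ,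
          ∃ (φ : GaloisField p (e n) →+* AlgebraicClosure (ZMod p))
            (P : ArithCircuit (GaloisField p (e n)) (Fin n)),
            P.IsFanInTwo ∧ P.size ≤ s n ∧
              ∀ x : Fin n → Bool,
                eval (boolPoint (AlgebraicClosure (ZMod p)) x) (P.map φ).eval
                  = eval (boolPoint (AlgebraicClosure (ZMod p)) x) (f n))
    (hSimulation : ∀ (p : ℕ) [Fact p.Prime]
      (f : (n : ℕ) → MvPolynomial (Fin n) (AlgebraicClosure (ZMod p))),
      (∀ n (x : Fin n → Bool), ∃ N : ℕ, eval (boolPoint (AlgebraicClosure (ZMod p)) x) (f n) = N) →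
      (∃ e s : ℕ → ℕ, IsPBounded e ∧ IsPBounded s ∧ ∀ n : ℕ,
          ∃ (φ : GaloisField p (e n) →+* AlgebraicClosure (ZMod p))
            (P : ArithCircuit (GaloisField p (e n)) (Fin n)),
            P.IsFanInTwo ∧ P.size ≤ s n ∧
              ∀ x : Fin n → Bool,
                eval (boolPoint (AlgebraicClosure (ZMod p)) x) (P.map φ).eval
                  = eval (boolPoint (AlgebraicClosure (ZMod p)) x) (f n)) →
      ∀ a : AlgebraicClosure (ZMod p),
        {w : List Bool | eval (boolPoint (AlgebraicClosure (ZMod p)) w.get) (f w.length) = a} ∈ PPoly) :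
    ∀ (p : ℕ) [Fact p.Prime],
      VP (AlgebraicClosure (ZMod p)) = VNP (AlgebraicClosure (ZMod p)) → NP ⊆ PPoly := by
  intro p hp hVP
  -- `Mod_pNP ⊆ P/poly` over `F̄_p` from the two stubs (Bürgisser TCS p. 79 with F̄_p for k)
  have hMod : ModpNP p ⊆ PPoly := by
    intro L hL
    obtain ⟨φ, hφ, hLφ⟩ := hL
    obtain ⟨f, hf, hfφ⟩ := sharpP_booleanPart_VNP_holds (AlgebraicClosure (ZMod p)) φ hφ
    have hfVP : IsVPFamily f := isVPFamily_of_VP_eq_VNP hVP hf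
    have hN : ∀ n (x : Fin n → Bool), ∃ N : ℕ,
        eval (boolPoint (AlgebraicClosure (ZMod p)) x) (f n) = N := fun n x => ⟨_, hfφ n x⟩
    have hmem := hSimulation p f hN (hDescent p hVP f hfVP hN) 1
    have hEq : L = {w : List Bool |
        eval (boolPoint (AlgebraicClosure (ZMod p)) w.get) (f w.length) = 1} := by
      ext w
      change w ∈ L ↔ eval (boolPoint (AlgebraicClosure (ZMod p)) w.get) (f w.length) = 1
      rw [hfφ w.length w.get, List.ofFn_get, natCast_eq_one_iff_mod p, hLφ w]
    rw [hEq]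
    exact hmem
  calc NP ⊆ polyAdvice (ModpNP p) := NP_subset_polyAdvice_ModpNP hp.out
    _ ⊆ polyAdvice PPoly := polyAdvice_mono hMod
    _ ⊆ PPoly := polyAdvice_subset_PPoly subset_rfl

/-- **THE SKELETON THEOREM: the crux `BoolTransfer.FpBarCollapse` BY NAME from the two registered
stubs BY NAME** (`stub_booleanDescent`, `stub_booleanSimulation`), through the sorry-free
composition `fpBarCollapse_of_descent_of_simulation`.  The only `sorry`s of the file sit inside the
two stubs; closing both stubs closes the crux. -/
theorem FpBarCollapse_of :
    Summit.ValiantsHypothesis.ValiantsHypothesis.Theses.BoolTransfer.FpBarCollapse :=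
  fun p _ hVP => fpBarCollapse_of_descent_of_simulation
    (fun q _ => stub_booleanDescent q) (fun q _ => stub_booleanSimulation q) p hVP

end Summit.ValiantsHypothesis.ValiantsHypothesis.Cruxes.FpBarCollapse.Birth
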